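import Mathlib
import HarnessLib
import Literature.Analysis.FluidPDE.BeltramiFlows
import Literature.Analysis.Calculus.SimplifiedNewton
import Summits.NavierStokesRegularity.FluidComputer.ABCAlphaPointStrain
import Summits.NavierStokesRegularity.FluidComputer.ABCStagnationSkeleton
import Summits.NavierStokesRegularity.FluidComputer.ABCStagnationJacobian

/-!
# The eight stagnation points of the ABC 1:1:1 host PERSIST, displaced `O(ε)`, under every `C¹`-small
# perturbation of the field — the quantitative form of the generic-arm prior «8 structurally stable skeleton zeros»
# (instab lane, door O-acc = O7 / obstruction P3; companion of `ABCStagnationSkeleton` / `ABCStagnationJacobian`;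
# cell `ns-blowup`, seat `ns-blowup-instab2`)

HONEST FRAMING (human ruling D-0035): nothing here is a claim about Navier–Stokes. WHAT THIS IS NOT: not dynamics —
calculus on the tree's ABC field `U = Literature.Analysis.FluidPDE.ABC.abc 1 1 1` on `E = EuclideanSpace ℝ (Fin 3)`
and the tree's simplified-Newton theorem `Literature.Analysis.Calculus.exists_zero_near_of_simplifiedNewton`
(Magnus 2022, Prop. 6.7). The «perturbation» `G` is an arbitrary `C¹` field with a Lipschitz derivative; in the
cell's use it is the instantaneous perturbation velocity `u(·,t) − U` of a P-TOWER run, and the theorem says where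
the zeros of the perturbed velocity field `u = U + G` must lie — it does not evolve anything.

## What is proved (Mathlib + `BeltramiFlows` + `SimplifiedNewton` + the `ABCAlphaPointStrain` / `ABCStagnationSkeleton`
/ `ABCStagnationJacobian` files; no definitions; private helpers: `‖w‖² = Σwᵢ²`, 1-Lipschitz `sin`/`cos`,
coordinate bound, two-term Cauchy–Schwarz)
* §1 COERCIVITY OF `∇U` AT A ZERO: `norm_fderiv_sq_eq_of_abc_eq_zero` — at every stagnation point
  `|DU(x)v|² = |v|² + 2(c₁c₂v₀v₁ + c₀c₁v₀v₂ + c₀c₂v₁v₂)`, `cᵢ = cos xᵢ`; `norm_fderiv_sq_eq_half_add_sq`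
  (`= ½|v|² + ½(v₀ + 2c₁c₂v₁ + 2c₀c₁v₂)²`: `∇U² − ½I` is `½wwᵀ`, rank one) hence **`half_norm_sq_le_norm_fderiv_sq`**
  (`|DU(x)v|² ≥ ½|v|²`) and `norm_le_norm_fderiv` (`(√2/2)|v| ≤ |DU(x)v|`): the Jacobian is bounded below by its
  smallest strain rate `√2/2` (`ABCStagnationJacobian`: rates `(±√2, ∓√2/2, ∓√2/2)`), uniformly over the eight zeros;
* §2 `exists_equiv_of_bound_below`: a continuous linear endomorphism of `E` bounded below by `c > 0` IS an
  isomorphism with `‖inverse‖ ≤ 1/c` (finite dimension); so `DU(x)` at a zero is an isomorphism with `‖DU(x)⁻¹‖ ≤ √2`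
  (`exists_equiv_fderiv_of_abc_eq_zero`), and so is `DU(x) + B` for any `‖B‖ ≤ δ₁ < √2/2`, with
  `‖(DU(x)+B)⁻¹‖ ≤ 1/(√2/2 − δ₁)` (`exists_equiv_fderiv_add`);
* §3 LIPSCHITZ JACOBIAN: `fderiv_abc_apply` (components of `DU(x)v`), `abs_cos_coord_sub_le` / `abs_sin_coord_sub_le`
  (each Jacobian entry moves by `≤ ‖x − y‖`), **`norm_fderiv_sub_fderiv_le`** (`‖DU(x) − DU(y)‖ ≤ 2‖x − y‖` for all
  `x, y`), `norm_fderiv_add_sub_le` (`DU + G'` is `(2 + M)`-Lipschitz when `G'` is `M`-Lipschitz);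
* §4 **PERSISTENCE** `exists_unique_zero_near_of_abc_eq_zero`: let `U x₀ = 0` (any of the eight), `G : E → E` with
  `HasFDerivAt G (G' x) x` everywhere, `‖G' x − G' y‖ ≤ M‖x − y‖`, `‖G' x₀‖ ≤ δ₁ < √2/2`, and the smallness
  `4(2 + M)‖G x₀‖ ≤ (√2/2 − δ₁)²`. Then there is a radius `r ≤ 2‖G x₀‖/(√2/2 − δ₁)` such that `U + G` has EXACTLY
  ONE zero `z` in the closed ball `B̄(x₀, r)`, and `D(U+G)(z)` is invertible (the displaced zero is again
  non-degenerate). In words: each skeleton zero moves by at most `2|G(x₀)|/(σ_α/2 − |∇G(x₀)|)` and cannot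
  disappear or split while the perturbation gradient at the point stays below `σ_α/2 = √2/2` and the amplitude
  below the stated threshold — the (g2) clause «8 zeros, displaced `O(ε)`, for `t ≲ t_rope`» of the census with
  its constants. (That no NINTH zero appears elsewhere in the cell needs a global bound on `G` away from the
  skeleton and is not claimed here.)
LABEL: MODEL-door kinematics. WHAT THIS IS NOT: not NS; nothing is evolved; `G` is a free field.
-/

namespace Summit.NavierStokesRegularity.FluidComputer.ABCSkeletonPersistence

open Real Metric Set Literature.Analysis.FluidPDE ABCStagnationSkeleton ABCStagnationJacobian

/-! ## §1 Coercivity of `∇U` at a stagnation point -/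

/-- Components of a vector of `E = EuclideanSpace ℝ (Fin 3)` square-sum to the norm squared. -/
private theorem norm_sq_eq_three (w : EuclideanSpace ℝ (Fin 3)) : ‖w‖ ^ 2 = w 0 ^ 2 + w 1 ^ 2 + w 2 ^ 2 := by
  rw [EuclideanSpace.norm_sq_eq, Fin.sum_univ_three]
  simp [sq_abs]

/-- `|DU(x)v|²` AT A STAGNATION POINT, raw form: `|v|² + 2(c₁c₂v₀v₁ + c₀c₁v₀v₂ + c₀c₂v₁v₂)` with `cᵢ = cos xᵢ`
(uses `∇U = [[0,c₀,c₂],[c₀,0,c₁],[c₂,c₁,0]]` and `cᵢ² = ½` from `ABCStagnationJacobian` / `ABCStagnationSkeleton`). -/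
theorem norm_fderiv_sq_eq_of_abc_eq_zero {x : EuclideanSpace ℝ (Fin 3)} (h : ABC.abc 1 1 1 x = 0)
    (v : EuclideanSpace ℝ (Fin 3)) :
    ‖fderiv ℝ (ABC.abc 1 1 1) x v‖ ^ 2 = ‖v‖ ^ 2 + 2 * (Real.cos (x 1) * Real.cos (x 2) * (v 0 * v 1) +
      Real.cos (x 0) * Real.cos (x 1) * (v 0 * v 2) + Real.cos (x 0) * Real.cos (x 2) * (v 1 * v 2)) := by
  have hc0 := cos_sq_eq_half_of_abc_eq_zero h 0
  have hc1 := cos_sq_eq_half_of_abc_eq_zero h 1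
  have hc2 := cos_sq_eq_half_of_abc_eq_zero h 2
  rw [norm_sq_eq_three, norm_sq_eq_three, ABCAlphaPointStrain.fderiv_abc_eq_sum,
    ABCAlphaPointStrain.fderiv_abc_eq_sum, ABCAlphaPointStrain.fderiv_abc_eq_sum, jac_eq_of_abc_eq_zero h]
  simp only [Fin.sum_univ_three]
  simp
  linear_combination (v 0 ^ 2 + v 1 ^ 2) * hc0 + (v 1 ^ 2 + v 2 ^ 2) * hc1 + (v 0 ^ 2 + v 2 ^ 2) * hc2

/-- COMPLETED SQUARE: `|DU(x)v|² = ½|v|² + ½(v₀ + 2c₁c₂v₁ + 2c₀c₁v₂)²` — the matrix `∇U² − ½I = ½wwᵀ` with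
`w = (1, 2c₁c₂, 2c₀c₁)` is positive semidefinite of rank one (its null plane is the `∓√2/2` eigenplane). -/
theorem norm_fderiv_sq_eq_half_add_sq {x : EuclideanSpace ℝ (Fin 3)} (h : ABC.abc 1 1 1 x = 0)
    (v : EuclideanSpace ℝ (Fin 3)) :
    ‖fderiv ℝ (ABC.abc 1 1 1) x v‖ ^ 2 = ‖v‖ ^ 2 / 2 +
      (v 0 + 2 * (Real.cos (x 1) * Real.cos (x 2)) * v 1 + 2 * (Real.cos (x 0) * Real.cos (x 1)) * v 2) ^ 2 / 2 := by
  have hc0 := cos_sq_eq_half_of_abc_eq_zero h 0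
  have hc1 := cos_sq_eq_half_of_abc_eq_zero h 1
  have hc2 := cos_sq_eq_half_of_abc_eq_zero h 2
  rw [norm_fderiv_sq_eq_of_abc_eq_zero h, norm_sq_eq_three]
  linear_combination (-(2 * Real.cos (x 2) ^ 2 * v 1 ^ 2) - 2 * Real.cos (x 0) ^ 2 * v 2 ^ 2 -
      4 * Real.cos (x 0) * Real.cos (x 2) * (v 1 * v 2)) * hc1 - v 1 ^ 2 * hc2 - v 2 ^ 2 * hc0

/-- **COERCIVITY**: `|DU(x)v|² ≥ ½|v|²` at every stagnation point, for every `v`. -/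
theorem half_norm_sq_le_norm_fderiv_sq {x : EuclideanSpace ℝ (Fin 3)} (h : ABC.abc 1 1 1 x = 0)
    (v : EuclideanSpace ℝ (Fin 3)) : ‖v‖ ^ 2 / 2 ≤ ‖fderiv ℝ (ABC.abc 1 1 1) x v‖ ^ 2 := by
  rw [norm_fderiv_sq_eq_half_add_sq h]
  nlinarith [sq_nonneg (v 0 + 2 * (Real.cos (x 1) * Real.cos (x 2)) * v 1 + 2 * (Real.cos (x 0) * Real.cos (x 1)) * v 2)]

/-- The same with norms: `(√2/2)·|v| ≤ |DU(x)v|` — `∇U` at a zero is bounded below by its smallest strain rate. -/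
theorem norm_le_norm_fderiv {x : EuclideanSpace ℝ (Fin 3)} (h : ABC.abc 1 1 1 x = 0)
    (v : EuclideanSpace ℝ (Fin 3)) : Real.sqrt 2 / 2 * ‖v‖ ≤ ‖fderiv ℝ (ABC.abc 1 1 1) x v‖ := by
  have h1 := half_norm_sq_le_norm_fderiv_sq h v
  have h2 : (Real.sqrt 2 / 2 * ‖v‖) ^ 2 = ‖v‖ ^ 2 / 2 := by
    rw [mul_pow, sqrt_two_div_two_sq]; ring
  have h3 : 0 ≤ Real.sqrt 2 / 2 * ‖v‖ := by positivity
  rw [← h2] at h1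
  exact (pow_le_pow_iff_left₀ h3 (norm_nonneg _) two_ne_zero).1 h1

/-! ## §2 Bounded below ⇒ isomorphism with controlled inverse (finite dimension) -/

/-- A continuous linear endomorphism of the finite-dimensional space `E` that is BOUNDED BELOW, `c|v| ≤ |Tv|` with
`c > 0`, is an isomorphism, and its inverse has operator norm `≤ 1/c`. (Injective ⇒ bijective by dimension count;
the bound is `c|T⁻¹y| ≤ |TT⁻¹y| = |y|`.) -/
theorem exists_equiv_of_bound_below (T : EuclideanSpace ℝ (Fin 3) →L[ℝ] EuclideanSpace ℝ (Fin 3)) {c : ℝ}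
    (hc : 0 < c) (hT : ∀ v, c * ‖v‖ ≤ ‖T v‖) :
    ∃ e : EuclideanSpace ℝ (Fin 3) ≃L[ℝ] EuclideanSpace ℝ (Fin 3),
      (e : EuclideanSpace ℝ (Fin 3) →L[ℝ] EuclideanSpace ℝ (Fin 3)) = T ∧
      ‖(e.symm : EuclideanSpace ℝ (Fin 3) →L[ℝ] EuclideanSpace ℝ (Fin 3))‖ ≤ 1 / c := by
  have hinj : Function.Injective T.toLinearMap := by
    intro v w hvw
    have h1 : T (v - w) = 0 := by
      have : T v = T w := hvw
      rw [map_sub, this, sub_self]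
    have h2 := hT (v - w)
    rw [h1, norm_zero] at h2
    have h3 : ‖v - w‖ ≤ 0 := by
      by_contra hne
      have := mul_pos hc (not_le.1 hne)
      linarith
    exact sub_eq_zero.1 (norm_le_zero_iff.1 h3)
  let L : EuclideanSpace ℝ (Fin 3) ≃ₗ[ℝ] EuclideanSpace ℝ (Fin 3) := T.toLinearMap.linearEquivOfInjective hinj rfl
  let e : EuclideanSpace ℝ (Fin 3) ≃L[ℝ] EuclideanSpace ℝ (Fin 3) := L.toContinuousLinearEquiv
  have he : ∀ v, e v = T v := fun v => by simp [e, L]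
  refine ⟨e, ?_, ?_⟩
  · ext v
    simp [he]
  · refine ContinuousLinearMap.opNorm_le_bound _ (by positivity) fun y => ?_
    have h := hT (e.symm y)
    rw [← he, e.apply_symm_apply] at h
    rw [ContinuousLinearEquiv.coe_coe, div_mul_eq_mul_div, one_mul, le_div_iff₀ hc]
    linarith

/-- `∇U` AT A ZERO IS AN ISOMORPHISM with `‖∇U⁻¹‖ ≤ √2` (`= 1/(√2/2)`, the reciprocal of the smallest strain rate). -/
theorem exists_equiv_fderiv_of_abc_eq_zero {x : EuclideanSpace ℝ (Fin 3)} (h : ABC.abc 1 1 1 x = 0) :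
    ∃ e : EuclideanSpace ℝ (Fin 3) ≃L[ℝ] EuclideanSpace ℝ (Fin 3),
      (e : EuclideanSpace ℝ (Fin 3) →L[ℝ] EuclideanSpace ℝ (Fin 3)) = fderiv ℝ (ABC.abc 1 1 1) x ∧
      ‖(e.symm : EuclideanSpace ℝ (Fin 3) →L[ℝ] EuclideanSpace ℝ (Fin 3))‖ ≤ 1 / (Real.sqrt 2 / 2) :=
  exists_equiv_of_bound_below _ (by positivity) (norm_le_norm_fderiv h)

/-- … AND SO IS EVERY SMALL PERTURBATION OF IT: for `‖B‖ ≤ δ₁ < √2/2`, `∇U(x) + B` is bounded below by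
`√2/2 − δ₁`, hence an isomorphism with `‖(∇U(x) + B)⁻¹‖ ≤ 1/(√2/2 − δ₁)`. -/
theorem exists_equiv_fderiv_add {x : EuclideanSpace ℝ (Fin 3)} (h : ABC.abc 1 1 1 x = 0)
    (B : EuclideanSpace ℝ (Fin 3) →L[ℝ] EuclideanSpace ℝ (Fin 3)) {δ₁ : ℝ} (hB : ‖B‖ ≤ δ₁)
    (hδ : δ₁ < Real.sqrt 2 / 2) :
    ∃ e : EuclideanSpace ℝ (Fin 3) ≃L[ℝ] EuclideanSpace ℝ (Fin 3),
      (e : EuclideanSpace ℝ (Fin 3) →L[ℝ] EuclideanSpace ℝ (Fin 3)) = fderiv ℝ (ABC.abc 1 1 1) x + B ∧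
      ‖(e.symm : EuclideanSpace ℝ (Fin 3) →L[ℝ] EuclideanSpace ℝ (Fin 3))‖ ≤ 1 / (Real.sqrt 2 / 2 - δ₁) := by
  refine exists_equiv_of_bound_below _ (by linarith) fun v => ?_
  have h1 := norm_le_norm_fderiv h v
  have h2 : ‖B v‖ ≤ δ₁ * ‖v‖ := (B.le_opNorm v).trans (mul_le_mul_of_nonneg_right hB (norm_nonneg v))
  have h3 : ‖fderiv ℝ (ABC.abc 1 1 1) x v‖ ≤ ‖fderiv ℝ (ABC.abc 1 1 1) x v + B v‖ + ‖B v‖ := by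
    have := norm_sub_le (fderiv ℝ (ABC.abc 1 1 1) x v + B v) (B v)
    rwa [add_sub_cancel_right] at this
  change (Real.sqrt 2 / 2 - δ₁) * ‖v‖ ≤ ‖fderiv ℝ (ABC.abc 1 1 1) x v + B v‖
  linarith

/-! ## §3 The Jacobian of `U` is `2`-Lipschitz -/

/-- `cos` is `1`-Lipschitz. -/
private theorem abs_cos_sub_cos_le (a b : ℝ) : |Real.cos a - Real.cos b| ≤ |a - b| := by
  have h := (convex_univ (𝕜 := ℝ) (E := ℝ)).norm_image_sub_le_of_norm_hasDerivWithin_le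
    (f := Real.cos) (f' := fun y => -Real.sin y) (C := 1) (fun y _ => (Real.hasDerivAt_cos y).hasDerivWithinAt)
    (fun y _ => by rw [norm_neg, Real.norm_eq_abs]; exact Real.abs_sin_le_one y) (mem_univ b) (mem_univ a)
  simpa [Real.norm_eq_abs] using h

/-- `sin` is `1`-Lipschitz. -/
private theorem abs_sin_sub_sin_le (a b : ℝ) : |Real.sin a - Real.sin b| ≤ |a - b| := by
  have h := (convex_univ (𝕜 := ℝ) (E := ℝ)).norm_image_sub_le_of_norm_hasDerivWithin_le
    (f := Real.sin) (f' := fun y => Real.cos y) (C := 1) (fun y _ => (Real.hasDerivAt_sin y).hasDerivWithinAt)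
    (fun y _ => by rw [Real.norm_eq_abs]; exact Real.abs_cos_le_one y) (mem_univ b) (mem_univ a)
  simpa [Real.norm_eq_abs] using h

/-- A coordinate difference is bounded by the Euclidean distance. -/
private theorem abs_sub_coord_le (x y : EuclideanSpace ℝ (Fin 3)) (k : Fin 3) : |x k - y k| ≤ ‖x - y‖ := by
  have := PiLp.norm_apply_le (x - y) k
  simpa [Real.norm_eq_abs] using this

/-- Hence each Jacobian entry moves by at most `‖x − y‖`: cosines … -/
theorem abs_cos_coord_sub_le (x y : EuclideanSpace ℝ (Fin 3)) (k : Fin 3) :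
    |Real.cos (x k) - Real.cos (y k)| ≤ ‖x - y‖ :=
  (abs_cos_sub_cos_le _ _).trans (abs_sub_coord_le x y k)

/-- … and sines. -/
theorem abs_sin_coord_sub_le (x y : EuclideanSpace ℝ (Fin 3)) (k : Fin 3) :
    |Real.sin (x k) - Real.sin (y k)| ≤ ‖x - y‖ :=
  (abs_sin_sub_sin_le _ _).trans (abs_sub_coord_le x y k)

/-- The components of `DU(x)v`: `(−v₁ sin x₁ + v₂ cos x₂, v₀ cos x₀ − v₂ sin x₂, −v₀ sin x₀ + v₁ cos x₁)`. -/
theorem fderiv_abc_apply (x v : EuclideanSpace ℝ (Fin 3)) :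
    fderiv ℝ (ABC.abc 1 1 1) x v 0 = -(v 1 * Real.sin (x 1)) + v 2 * Real.cos (x 2) ∧
    fderiv ℝ (ABC.abc 1 1 1) x v 1 = v 0 * Real.cos (x 0) - v 2 * Real.sin (x 2) ∧
    fderiv ℝ (ABC.abc 1 1 1) x v 2 = -(v 0 * Real.sin (x 0)) + v 1 * Real.cos (x 1) := by
  refine ⟨?_, ?_, ?_⟩ <;> rw [ABCAlphaPointStrain.fderiv_abc_eq_sum, Fin.sum_univ_three] <;>
    first | (simp [ABC.jac]; done) | (simp [ABC.jac]; ring)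

/-- Two-term Cauchy–Schwarz. -/
private theorem sq_add_le_mul (a b p q : ℝ) : (a * p + b * q) ^ 2 ≤ (a ^ 2 + b ^ 2) * (p ^ 2 + q ^ 2) := by
  nlinarith [sq_nonneg (a * q - b * p)]

/-- **THE JACOBIAN IS 2-LIPSCHITZ**: `‖DU(x) − DU(y)‖ ≤ 2‖x − y‖` for all `x, y ∈ E`. -/
theorem norm_fderiv_sub_fderiv_le (x y : EuclideanSpace ℝ (Fin 3)) :
    ‖fderiv ℝ (ABC.abc 1 1 1) x - fderiv ℝ (ABC.abc 1 1 1) y‖ ≤ 2 * ‖x - y‖ := by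
  refine ContinuousLinearMap.opNorm_le_bound _ (by positivity) fun v => ?_
  obtain ⟨ax0, ax1, ax2⟩ := fderiv_abc_apply x v
  obtain ⟨ay0, ay1, ay2⟩ := fderiv_abc_apply y v
  have hw : ‖(fderiv ℝ (ABC.abc 1 1 1) x - fderiv ℝ (ABC.abc 1 1 1) y) v‖ ^ 2 =
      (-(v 1) * (Real.sin (x 1) - Real.sin (y 1)) + v 2 * (Real.cos (x 2) - Real.cos (y 2))) ^ 2 +
      (v 0 * (Real.cos (x 0) - Real.cos (y 0)) + -(v 2) * (Real.sin (x 2) - Real.sin (y 2))) ^ 2 +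
      (-(v 0) * (Real.sin (x 0) - Real.sin (y 0)) + v 1 * (Real.cos (x 1) - Real.cos (y 1))) ^ 2 := by
    rw [norm_sq_eq_three,
      show (fderiv ℝ (ABC.abc 1 1 1) x - fderiv ℝ (ABC.abc 1 1 1) y) v =
        fderiv ℝ (ABC.abc 1 1 1) x v - fderiv ℝ (ABC.abc 1 1 1) y v from rfl]
    simp only [PiLp.sub_apply, ax0, ax1, ax2, ay0, ay1, ay2]
    ring
  have bs0 := abs_le.1 (abs_sin_coord_sub_le x y 0)
  have bs1 := abs_le.1 (abs_sin_coord_sub_le x y 1)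
  have bs2 := abs_le.1 (abs_sin_coord_sub_le x y 2)
  have bc0 := abs_le.1 (abs_cos_coord_sub_le x y 0)
  have bc1 := abs_le.1 (abs_cos_coord_sub_le x y 1)
  have bc2 := abs_le.1 (abs_cos_coord_sub_le x y 2)
  have qs0 := sq_le_sq' bs0.1 bs0.2
  have qs1 := sq_le_sq' bs1.1 bs1.2
  have qs2 := sq_le_sq' bs2.1 bs2.2
  have qc0 := sq_le_sq' bc0.1 bc0.2
  have qc1 := sq_le_sq' bc1.1 bc1.2
  have qc2 := sq_le_sq' bc2.1 bc2.2
  have f0 : (-(v 1) * (Real.sin (x 1) - Real.sin (y 1)) + v 2 * (Real.cos (x 2) - Real.cos (y 2))) ^ 2 ≤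
      (v 1 ^ 2 + v 2 ^ 2) * (2 * ‖x - y‖ ^ 2) := by
    refine (sq_add_le_mul _ _ _ _).trans ?_
    rw [neg_sq]
    exact mul_le_mul_of_nonneg_left (by linarith) (by positivity)
  have f1 : (v 0 * (Real.cos (x 0) - Real.cos (y 0)) + -(v 2) * (Real.sin (x 2) - Real.sin (y 2))) ^ 2 ≤
      (v 0 ^ 2 + v 2 ^ 2) * (2 * ‖x - y‖ ^ 2) := by
    refine (sq_add_le_mul _ _ _ _).trans ?_
    rw [neg_sq]
    exact mul_le_mul_of_nonneg_left (by linarith) (by positivity)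
  have f2 : (-(v 0) * (Real.sin (x 0) - Real.sin (y 0)) + v 1 * (Real.cos (x 1) - Real.cos (y 1))) ^ 2 ≤
      (v 0 ^ 2 + v 1 ^ 2) * (2 * ‖x - y‖ ^ 2) := by
    refine (sq_add_le_mul _ _ _ _).trans ?_
    rw [neg_sq]
    exact mul_le_mul_of_nonneg_left (by linarith) (by positivity)
  have hv : (2 * ‖x - y‖ * ‖v‖) ^ 2 = 4 * ‖x - y‖ ^ 2 * (v 0 ^ 2 + v 1 ^ 2 + v 2 ^ 2) := by
    rw [show (2 * ‖x - y‖ * ‖v‖) ^ 2 = 4 * ‖x - y‖ ^ 2 * ‖v‖ ^ 2 by ring, norm_sq_eq_three v]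
  have key : ‖(fderiv ℝ (ABC.abc 1 1 1) x - fderiv ℝ (ABC.abc 1 1 1) y) v‖ ^ 2 ≤ (2 * ‖x - y‖ * ‖v‖) ^ 2 := by
    rw [hw, hv]
    have := add_le_add (add_le_add f0 f1) f2
    linarith
  exact (pow_le_pow_iff_left₀ (norm_nonneg _) (by positivity) two_ne_zero).1 key

/-! ## §4 Persistence of each stagnation point under a `C¹`-small perturbation -/

/-- The perturbed field's Jacobian is `(2 + M)`-Lipschitz when `G'` is `M`-Lipschitz. -/
theorem norm_fderiv_add_sub_le {G' : EuclideanSpace ℝ (Fin 3) → EuclideanSpace ℝ (Fin 3) →L[ℝ] EuclideanSpace ℝ (Fin 3)}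
    {M : ℝ} (hlipG : ∀ x y, ‖G' x - G' y‖ ≤ M * ‖x - y‖) (x y : EuclideanSpace ℝ (Fin 3)) :
    ‖(fderiv ℝ (ABC.abc 1 1 1) x + G' x) - (fderiv ℝ (ABC.abc 1 1 1) y + G' y)‖ ≤ (2 + M) * ‖x - y‖ := by
  calc ‖(fderiv ℝ (ABC.abc 1 1 1) x + G' x) - (fderiv ℝ (ABC.abc 1 1 1) y + G' y)‖
      = ‖(fderiv ℝ (ABC.abc 1 1 1) x - fderiv ℝ (ABC.abc 1 1 1) y) + (G' x - G' y)‖ := by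
        congr 1; abel
    _ ≤ ‖fderiv ℝ (ABC.abc 1 1 1) x - fderiv ℝ (ABC.abc 1 1 1) y‖ + ‖G' x - G' y‖ := norm_add_le _ _
    _ ≤ 2 * ‖x - y‖ + M * ‖x - y‖ := add_le_add (norm_fderiv_sub_fderiv_le x y) (hlipG x y)
    _ = (2 + M) * ‖x - y‖ := by ring

/-- **PERSISTENCE OF A STAGNATION POINT.** Let `U x₀ = 0` (any of the eight skeleton zeros of the ABC 1:1:1 host),
and let `G` be a `C¹` field on `E` with `M`-Lipschitz derivative `G'`, whose gradient AT THE POINT is smaller than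
the smallest host strain rate, `‖G'(x₀)‖ ≤ δ₁ < √2/2`, and whose value at the point is small:
`4(2 + M)·‖G(x₀)‖ ≤ (√2/2 − δ₁)²`. Then there is a radius `r ≤ 2‖G(x₀)‖/(√2/2 − δ₁)` such that the perturbed field
`U + G` has EXACTLY ONE zero `z` in the closed ball `B̄(x₀, r)`, and that zero is again NON-DEGENERATE
(`D(U+G)(z)` invertible). So each skeleton zero is DISPLACED by at most `2|G(x₀)|/(σ_α/2 − |∇G(x₀)|)` — `O(ε)` for an
`O(ε)` perturbation — and neither disappears nor splits while these smallness conditions hold: the (g2) clause of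
the generic-arm census prior, with constants (Magnus 2022 Prop. 6.7 = tree `exists_zero_near_of_simplifiedNewton`,
applied with `A = DU(x₀) + G'(x₀)`, `‖A⁻¹‖ ≤ 1/(√2/2 − δ₁)`, Lipschitz constant `2 + M`). -/
theorem exists_unique_zero_near_of_abc_eq_zero {x₀ : EuclideanSpace ℝ (Fin 3)} (h0 : ABC.abc 1 1 1 x₀ = 0)
    {G : EuclideanSpace ℝ (Fin 3) → EuclideanSpace ℝ (Fin 3)}
    {G' : EuclideanSpace ℝ (Fin 3) → EuclideanSpace ℝ (Fin 3) →L[ℝ] EuclideanSpace ℝ (Fin 3)}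
    {M δ₁ : ℝ} (hM : 0 ≤ M) (hδ : δ₁ < Real.sqrt 2 / 2)
    (hG : ∀ x, HasFDerivAt G (G' x) x) (hlipG : ∀ x y, ‖G' x - G' y‖ ≤ M * ‖x - y‖)
    (hG' : ‖G' x₀‖ ≤ δ₁) (hsmall : 4 * (2 + M) * ‖G x₀‖ ≤ (Real.sqrt 2 / 2 - δ₁) ^ 2) :
    ∃ r : ℝ, 0 ≤ r ∧ r ≤ 2 * ‖G x₀‖ / (Real.sqrt 2 / 2 - δ₁) ∧
      ∃ z ∈ closedBall x₀ r, ABC.abc 1 1 1 z + G z = 0 ∧ (fderiv ℝ (ABC.abc 1 1 1) z + G' z).IsInvertible ∧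
        ∀ y ∈ closedBall x₀ r, ABC.abc 1 1 1 y + G y = 0 → y = z := by
  set c : ℝ := Real.sqrt 2 / 2 - δ₁ with hc_def
  have hc : 0 < c := by rw [hc_def]; linarith
  -- the frozen Jacobian `A = DU(x₀) + G'(x₀)` as an isomorphism with `‖A⁻¹‖ ≤ 1/c`
  obtain ⟨e, he, hβ⟩ := exists_equiv_fderiv_add h0 (G' x₀) hG' hδ
  set f : EuclideanSpace ℝ (Fin 3) → EuclideanSpace ℝ (Fin 3) := fun x => ABC.abc 1 1 1 x + G x with hf_def
  set f' : EuclideanSpace ℝ (Fin 3) → EuclideanSpace ℝ (Fin 3) →L[ℝ] EuclideanSpace ℝ (Fin 3) :=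
    fun x => fderiv ℝ (ABC.abc 1 1 1) x + G' x with hf'_def
  have hf : ∀ x, HasFDerivAt f (f' x) x := fun x =>
    ((ABC.differentiable_abc 1 1 1 x).hasFDerivAt).add (hG x)
  have ha : f' x₀ = (e : EuclideanSpace ℝ (Fin 3) →L[ℝ] EuclideanSpace ℝ (Fin 3)) := by rw [he]
  have hfa : f x₀ = G x₀ := by simp [hf_def, h0]
  -- `η = ‖A⁻¹ f(x₀)‖ ≤ ‖G x₀‖ / c`
  set η : ℝ := ‖e.symm (f x₀)‖ with hη_def
  have hβ0 : 0 ≤ ‖(e.symm : EuclideanSpace ℝ (Fin 3) →L[ℝ] EuclideanSpace ℝ (Fin 3))‖ := norm_nonneg _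
  have hη : η ≤ ‖G x₀‖ / c := by
    rw [hη_def, hfa]
    calc ‖e.symm (G x₀)‖ = ‖(e.symm : EuclideanSpace ℝ (Fin 3) →L[ℝ] EuclideanSpace ℝ (Fin 3)) (G x₀)‖ := rfl
      _ ≤ ‖(e.symm : EuclideanSpace ℝ (Fin 3) →L[ℝ] EuclideanSpace ℝ (Fin 3))‖ * ‖G x₀‖ :=
          ContinuousLinearMap.le_opNorm _ _
      _ ≤ 1 / c * ‖G x₀‖ := mul_le_mul_of_nonneg_right hβ (norm_nonneg _)
      _ = ‖G x₀‖ / c := by ring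
  have hη0 : 0 ≤ η := norm_nonneg _
  -- Magnus's smallness condition `4·(2+M)·‖A⁻¹‖·η ≤ 1`
  have hcond : 4 * (2 + M) * ‖(e.symm : EuclideanSpace ℝ (Fin 3) →L[ℝ] EuclideanSpace ℝ (Fin 3))‖ * η ≤ 1 := by
    have h1 : 4 * (2 + M) * ‖(e.symm : EuclideanSpace ℝ (Fin 3) →L[ℝ] EuclideanSpace ℝ (Fin 3))‖ * η ≤
        4 * (2 + M) * (1 / c) * (‖G x₀‖ / c) := by
      have h2M : 0 ≤ 4 * (2 + M) := by positivity
      calc 4 * (2 + M) * ‖(e.symm : EuclideanSpace ℝ (Fin 3) →L[ℝ] EuclideanSpace ℝ (Fin 3))‖ * η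
          ≤ 4 * (2 + M) * (1 / c) * η := by gcongr
        _ ≤ 4 * (2 + M) * (1 / c) * (‖G x₀‖ / c) := by gcongr
    have h2 : 4 * (2 + M) * (1 / c) * (‖G x₀‖ / c) = (4 * (2 + M) * ‖G x₀‖) / c ^ 2 := by
      field_simp
    have h3 : (4 * (2 + M) * ‖G x₀‖) / c ^ 2 ≤ 1 := by
      rw [div_le_one (by positivity)]; exact hsmall
    exact h1.trans (h2.le.trans h3)
  obtain ⟨z, hz, hfz, hinv, huniq, -⟩ :=
    Literature.Analysis.Calculus.exists_zero_near_of_simplifiedNewton (f := f) (f' := f') (a := x₀) (A := e)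
      (M := 2 + M) (by positivity) (fun x _ => hf x) ha (fun x _ => norm_fderiv_add_sub_le hlipG x x₀) hcond
  refine ⟨2 * η, by positivity, ?_, z, hz, hfz, hinv, huniq⟩
  rw [mul_div_assoc]
  exact mul_le_mul_of_nonneg_left hη (by norm_num)

end Summit.NavierStokesRegularity.FluidComputer.ABCSkeletonPersistence
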